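import Literature.MathematicalPhysics.QuantumLattice.OverlapLocality
import Literature.MathematicalPhysics.QuantumLattice.ApproximateEigenvectorLemmas
import HarnessLib

/-!
# Neuberger's bound on the Wilson–Dirac operator, I: algebra of the four hopping unitaries

Topic `Literature/MathematicalPhysics/QuantumLattice`; namespace
`Literature.MathematicalPhysics.QuantumLattice.NeubergerBound` (grouping named after the paper).
First of three files proving H. Neuberger's lower bound [Neuberger2000Bounds, §"Lower bound"]
on `D_W(m)ᴴ D_W(m)` in the ABSTRACT setting of four unitaries `F_μ` ("directional parallel
transporters" `T_μ`) on a finite-dimensional colour space `ℂⁿ` and the Euclidean gamma matrices: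
`D = (m + 4)·1 − Σ_μ W_μ`, `W_μ = F_μ ⊗ P⁻_μ + F_μᴴ ⊗ P⁺_μ` (`= V_μ`), `P^∓_μ = ½(1 ∓ γ_μ)`.

Scaled variables (no fractions): `B_μ = 1 − F_μ`, `K_μ = B_μ + B_μᴴ = 2(1 − h_μ)`,
`Δ_μ = F_μᴴ − F_μ` (`a_μ = ½ Δ_μ ⊗ γ_μ`).  Proved here: `B Bᴴ = Bᴴ B = K`; Neuberger's `Q + X`
splitting `2 K_μ K_ν = (B_μ K_ν B_μᴴ + B_μᴴ K_ν B_μ) − (B_μ[K_ν, B_μᴴ] + B_μᴴ[K_ν, B_μ])`; the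
commutators `[K_ν, B_μ^{(†)}]`, `[K_μ, Δ_ν]`, `[Δ_μ, Δ_ν]` as signed sums of the mixed commutators
`[F_μ^{(†)}, F_ν^{(†)}]`; `W_μᴴ W_μ = 1`; `2(1 − W_μ) = K_μ ⊗ 1 − (Δ_μ ⊗ 1)(1 ⊗ γ_μ)`; and the
quadratic-form bounds that only use "the mixed commutators are `δ`-small on vectors supported in
`S`" (hypothesis written out in each statement): `K ≥ 0`, `‖B^{(†)}w‖ ≤ 2‖w‖`,
`‖[K_μ, Δ_ν]w‖, ‖[Δ_μ, Δ_ν]w‖ ≤ 4δ‖w‖`, `Re⟨K_μ w, K_ν w⟩ ≥ −4δ‖w‖²`.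
Vectors are `n → ℂ` with `eucNorm`/`star _ ⬝ᵥ _` (`ApproximateEigenvectorLemmas`).
Continued in `WilsonHoppingBound.lean` (spin structure, per-pair bound, the abstract theorem) and
`WilsonDiracLowerBound.lean` (the lattice statement).

Reference: H. Neuberger, *Bounds on the Wilson Dirac operator*, Phys. Rev. D 61 (2000) 085015,
arXiv:hep-lat/9911004, §"Lower bound" (read: arXiv text, pp. 3–5). [Neuberger2000Bounds]
-/

noncomputable section

open Matrix Finset
open scoped Kronecker ComplexOrder

namespace Literature.MathematicalPhysics.QuantumLattice.NeubergerBound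

section Helpers

variable {n m : Type*} [Fintype n] [Fintype m]

/-- Entries of `(C ⊗ 1) v`: `((C ⊗ 1) v)(p, α) = (C v(·, α))(p)`. [folklore] -/
theorem kronecker_one_mulVec_apply [DecidableEq m] (C : Matrix n n ℂ) (v : n × m → ℂ) (p : n)
    (α : m) : ((C ⊗ₖ (1 : Matrix m m ℂ)) *ᵥ v) (p, α) = (C *ᵥ fun q => v (q, α)) p := by
  rw [mulVec, dotProduct, Fintype.sum_prod_type, mulVec, dotProduct]
  refine Finset.sum_congr rfl fun q _ => ?_
  simp only [kroneckerMap_apply, one_apply, mul_ite, mul_one, mul_zero, ite_mul, zero_mul,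
    Finset.sum_ite_eq, Finset.mem_univ, if_true]

/-- Entries of `(1 ⊗ Γ) v`: `((1 ⊗ Γ) v)(p, α) = (Γ v(p, ·))(α)`. [folklore] -/
theorem one_kronecker_mulVec_apply [DecidableEq n] (Γ : Matrix m m ℂ) (v : n × m → ℂ) (p : n)
    (α : m) : (((1 : Matrix n n ℂ) ⊗ₖ Γ) *ᵥ v) (p, α) = (Γ *ᵥ fun β => v (p, β)) α := by
  rw [mulVec, dotProduct, Fintype.sum_prod_type, mulVec, dotProduct,
    Finset.sum_eq_single_of_mem p (Finset.mem_univ _)]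
  · refine Finset.sum_congr rfl fun β _ => ?_
    simp only [kroneckerMap_apply, one_apply_eq, one_mul]
  · intro q _ hq
    simp only [kroneckerMap_apply, one_apply_ne' hq, zero_mul, Finset.sum_const_zero]

/-- `‖v‖₂² = Σ_i |v_i|²`. [folklore] -/
theorem eucNorm_sq_eq_sum (v : n → ℂ) : eucNorm v ^ 2 = ∑ i, ‖v i‖ ^ 2 := by
  rw [eucNorm, EuclideanSpace.norm_sq_eq]

/-- `‖v‖₂² = Σ_α ‖v(·, α)‖₂²` (slicing the second index). [folklore] -/
theorem eucNorm_sq_eq_sum_slices (v : n × m → ℂ) :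
    eucNorm v ^ 2 = ∑ α, eucNorm (fun p => v (p, α)) ^ 2 := by
  simp only [eucNorm_sq_eq_sum]
  rw [Fintype.sum_prod_type, Finset.sum_comm]

/-- `⟨u, v⟩ = Σ_α ⟨u(·, α), v(·, α)⟩` (slicing the second index). [folklore] -/
theorem star_dotProduct_eq_sum_slices (u v : n × m → ℂ) :
    star u ⬝ᵥ v = ∑ α, star (fun p => u (p, α)) ⬝ᵥ fun p => v (p, α) := by
  simp only [dotProduct, Pi.star_apply]
  rw [Fintype.sum_prod_type, Finset.sum_comm]

/-- `⟨u, M w⟩ = conj ⟨w, Mᴴ u⟩`. [folklore] -/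
theorem star_dotProduct_mulVec_eq_conj (M : Matrix n n ℂ) (u w : n → ℂ) :
    star u ⬝ᵥ (M *ᵥ w) = star (star w ⬝ᵥ (Mᴴ *ᵥ u)) := by
  rw [star_dotProduct, star_mulVec, ← dotProduct_mulVec]

/-- `Re ⟨u, Mᴴ u⟩ = Re ⟨u, M u⟩`. [folklore] -/
theorem re_star_dotProduct_conjTranspose_mulVec (M : Matrix n n ℂ) (u : n → ℂ) :
    (star u ⬝ᵥ (Mᴴ *ᵥ u)).re = (star u ⬝ᵥ (M *ᵥ u)).re := by
  rw [star_dotProduct_mulVec_eq_conj M u u, Complex.star_def, Complex.conj_re]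

/-- `|Re ⟨u, w⟩| ≤ ‖u‖ ‖w‖`. [folklore] -/
theorem abs_re_star_dotProduct_le (u w : n → ℂ) :
    |(star u ⬝ᵥ w).re| ≤ eucNorm u * eucNorm w :=
  (Complex.abs_re_le_norm _).trans (norm_star_dotProduct_le u w)

/-- `Re ⟨u, u⟩ = ‖u‖²` restated. [folklore] -/
theorem re_star_dotProduct_self (u : n → ℂ) : (star u ⬝ᵥ u).re = eucNorm u ^ 2 :=
  (eucNorm_sq u).symm

/-- `A ⊗ (B₁ - B₂) = A ⊗ B₁ - A ⊗ B₂`. [folklore] -/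
theorem kronecker_sub {l p : Type*} (A : Matrix l l ℂ) (B₁ B₂ : Matrix p p ℂ) :
    A ⊗ₖ (B₁ - B₂) = A ⊗ₖ B₁ - A ⊗ₖ B₂ := by
  ext ⟨i, j⟩ ⟨k, l⟩
  simp [kroneckerMap_apply, mul_sub]

/-- `(A₁ - A₂) ⊗ B = A₁ ⊗ B - A₂ ⊗ B`. [folklore] -/
theorem sub_kronecker {l p : Type*} (A₁ A₂ : Matrix l l ℂ) (B : Matrix p p ℂ) :
    (A₁ - A₂) ⊗ₖ B = A₁ ⊗ₖ B - A₂ ⊗ₖ B := by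
  ext ⟨i, j⟩ ⟨k, l⟩
  simp [kroneckerMap_apply, sub_mul]

end Helpers

section HoppingAlgebra

variable {n : Type*} [Fintype n] [DecidableEq n] (F : Fin 4 → Matrix n n ℂ)


/-- `(1 − F)(1 − F)ᴴ = (1 − F) + (1 − F)ᴴ` (`= 2(1 − h)`) when `F Fᴴ = 1`. [folklore] -/
theorem one_sub_mul_one_sub_conjTranspose (hF' : ∀ μ, F μ * (F μ)ᴴ = 1) (μ : Fin 4) :
    (1 - F μ) * (1 - F μ)ᴴ = (1 - F μ + (1 - (F μ)ᴴ)) := by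
  rw [conjTranspose_sub, conjTranspose_one, sub_mul, mul_sub, mul_sub, one_mul, one_mul, mul_one,
    hF']
  abel

/-- `(1 − F)ᴴ(1 − F) = (1 − F) + (1 − F)ᴴ` when `Fᴴ F = 1`. [folklore] -/
theorem one_sub_conjTranspose_mul_one_sub (hF : ∀ μ, (F μ)ᴴ * F μ = 1) (μ : Fin 4) :
    (1 - F μ)ᴴ * (1 - F μ) = (1 - F μ + (1 - (F μ)ᴴ)) := by
  rw [conjTranspose_sub, conjTranspose_one, sub_mul, mul_sub, mul_sub, one_mul, one_mul, mul_one,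
    hF]
  abel

/-- **Neuberger's `Q + X` splitting of `(1 − h_μ)(1 − h_ν)`** in the scaled variables
`K_μ = 2(1 − h_μ) = B_μ + B_μᴴ`, `B_μ = 1 − F_μ`:
`2 K_μ K_ν = (B_μ K_ν B_μᴴ + B_μᴴ K_ν B_μ) − (B_μ [K_ν, B_μᴴ] + B_μᴴ [K_ν, B_μ])`, the first bracket
being positive and the second a sum of commutators. [cite: Neuberger2000Bounds, §Lower bound] -/
theorem two_nsmul_K_mul_K (hF : ∀ μ, (F μ)ᴴ * F μ = 1) (hF' : ∀ μ, F μ * (F μ)ᴴ = 1)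
    (μ ν : Fin 4) :
    2 • ((1 - F μ + (1 - (F μ)ᴴ)) * (1 - F ν + (1 - (F ν)ᴴ))) =
      ((1 - F μ) * (1 - F ν + (1 - (F ν)ᴴ)) * (1 - F μ)ᴴ +
          (1 - F μ)ᴴ * (1 - F ν + (1 - (F ν)ᴴ)) * (1 - F μ)) -
        ((1 - F μ) *
            ((1 - F ν + (1 - (F ν)ᴴ)) * (1 - F μ)ᴴ - (1 - F μ)ᴴ * (1 - F ν + (1 - (F ν)ᴴ))) +
          (1 - F μ)ᴴ *
            ((1 - F ν + (1 - (F ν)ᴴ)) * (1 - F μ) - (1 - F μ) * (1 - F ν + (1 - (F ν)ᴴ)))) := by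
  rw [two_nsmul]
  conv_lhs => rw [← one_sub_mul_one_sub_conjTranspose F hF' μ]
  conv_lhs => arg 2; rw [one_sub_mul_one_sub_conjTranspose F hF' μ,
    ← one_sub_conjTranspose_mul_one_sub F hF μ]
  noncomm_ring

/-- `[K_ν, B_μᴴ] = [F_ν, F_μᴴ] + [F_νᴴ, F_μᴴ]`. [folklore] -/
theorem K_comm_one_sub_conjTranspose (μ ν : Fin 4) :
    (1 - F ν + (1 - (F ν)ᴴ)) * (1 - F μ)ᴴ - (1 - F μ)ᴴ * (1 - F ν + (1 - (F ν)ᴴ)) =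
      (F ν * (F μ)ᴴ - (F μ)ᴴ * F ν) + ((F ν)ᴴ * (F μ)ᴴ - (F μ)ᴴ * (F ν)ᴴ) := by
  rw [conjTranspose_sub, conjTranspose_one]
  noncomm_ring

/-- `[K_ν, B_μ] = −[F_μ, F_ν] − [F_μ, F_νᴴ]`. [folklore] -/
theorem K_comm_one_sub (μ ν : Fin 4) :
    (1 - F ν + (1 - (F ν)ᴴ)) * (1 - F μ) - (1 - F μ) * (1 - F ν + (1 - (F ν)ᴴ)) =
      -(F μ * F ν - F ν * F μ) - (F μ * (F ν)ᴴ - (F ν)ᴴ * F μ) := by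
  noncomm_ring

/-- `[K_μ, Δ_ν]` (`Δ_ν = F_νᴴ − F_ν = 2a_ν` without its `γ_ν`) as a signed sum of four mixed
commutators `[F_μ^{(†)}, F_ν^{(†)}]` (Neuberger's `Z` term).
[cite: Neuberger2000Bounds, §Lower bound] -/
theorem K_comm_delta (μ ν : Fin 4) :
    (1 - F μ + (1 - (F μ)ᴴ)) * ((F ν)ᴴ - F ν) - ((F ν)ᴴ - F ν) * (1 - F μ + (1 - (F μ)ᴴ)) =
      -((F μ * (F ν)ᴴ - (F ν)ᴴ * F μ) - (F μ * F ν - F ν * F μ) +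
        ((F μ)ᴴ * (F ν)ᴴ - (F ν)ᴴ * (F μ)ᴴ) + (F ν * (F μ)ᴴ - (F μ)ᴴ * F ν)) := by
  noncomm_ring

/-- `[Δ_μ, Δ_ν]` as a signed sum of four mixed commutators (Neuberger's `Y` term).
[cite: Neuberger2000Bounds, §Lower bound] -/
theorem delta_comm_delta (μ ν : Fin 4) :
    ((F μ)ᴴ - F μ) * ((F ν)ᴴ - F ν) - ((F ν)ᴴ - F ν) * ((F μ)ᴴ - F μ) =
      ((F μ)ᴴ * (F ν)ᴴ - (F ν)ᴴ * (F μ)ᴴ) + (F μ * F ν - F ν * F μ) +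
        (F ν * (F μ)ᴴ - (F μ)ᴴ * F ν) - (F μ * (F ν)ᴴ - (F ν)ᴴ * F μ) := by
  noncomm_ring

/-- **The hopping matrix is unitary**: `W_μᴴ W_μ = 1` for `W_μ = F_μ ⊗ P⁻_μ + F_μᴴ ⊗ P⁺_μ`
(`V_μ† V_μ = 1` in Neuberger's notation; cf. `conjTranspose_mul_wilsonHop`).
[cite: Neuberger2000Bounds, §Lower bound] -/
theorem conjTranspose_Wk_mul_Wk (hF : ∀ μ, (F μ)ᴴ * F μ = 1) (hF' : ∀ μ, F μ * (F μ)ᴴ = 1)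
    (μ : Fin 4) :
    (F μ ⊗ₖ chiralProjMinus μ + (F μ)ᴴ ⊗ₖ chiralProjPlus μ)ᴴ *
      (F μ ⊗ₖ chiralProjMinus μ + (F μ)ᴴ ⊗ₖ chiralProjPlus μ) = 1 := by
  rw [conjTranspose_add, conjTranspose_kronecker, conjTranspose_kronecker,
    conjTranspose_conjTranspose, chiralProjMinus_conjTranspose, chiralProjPlus_conjTranspose,
    add_mul, mul_add, mul_add, ← mul_kronecker_mul, ← mul_kronecker_mul, ← mul_kronecker_mul,
    ← mul_kronecker_mul, hF, hF', chiralProjMinus_mul_self, chiralProjMinus_mul_chiralProjPlus,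
    chiralProjPlus_mul_chiralProjMinus, chiralProjPlus_mul_self, kronecker_zero, kronecker_zero,
    add_zero, zero_add, ← kronecker_add, chiralProjMinus_add_chiralProjPlus, one_kronecker_one]

/-- **`h`/`a` decomposition of the hopping defect**: `2(1 − W_μ) = K_μ ⊗ 1 − (Δ_μ ⊗ 1)(1 ⊗ γ_μ)`,
i.e. `1 − V_μ = (1 − h_μ) − a_μ` with `h_μ = ½(T_μ + T_μ†) ⊗ 1`, `a_μ = ½(T_μ† − T_μ) ⊗ γ_μ`.
[cite: Neuberger2000Bounds, §Lower bound] -/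
theorem two_smul_one_sub_Wk (μ : Fin 4) :
    (2 : ℂ) • ((1 : Matrix (n × Fin 4) (n × Fin 4) ℂ) -
        (F μ ⊗ₖ chiralProjMinus μ + (F μ)ᴴ ⊗ₖ chiralProjPlus μ)) =
      (1 - F μ + (1 - (F μ)ᴴ)) ⊗ₖ (1 : Matrix (Fin 4) (Fin 4) ℂ) -
        (((F μ)ᴴ - F μ) ⊗ₖ (1 : Matrix (Fin 4) (Fin 4) ℂ)) *
          ((1 : Matrix n n ℂ) ⊗ₖ euclideanGamma μ) := by
  rw [← mul_kronecker_mul, mul_one, one_mul, chiralProjMinus, chiralProjPlus, kronecker_smul,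
    kronecker_smul, ← one_kronecker_one]
  simp only [smul_sub, smul_add, smul_smul, mul_inv_cancel₀ (two_ne_zero' ℂ), one_smul,
    kronecker_sub, kronecker_add, sub_kronecker, add_kronecker]
  rw [two_smul]
  abel

end HoppingAlgebra

section HoppingBounds

variable {n : Type*} [Fintype n] [DecidableEq n] (F : Fin 4 → Matrix n n ℂ)


/-- `Re ⟨u, (1 - F) u⟩ ≥ 0` for an isometry `F`. [folklore] -/
theorem re_star_dotProduct_one_sub_mulVec_nonneg (hF : ∀ μ, (F μ)ᴴ * F μ = 1) (μ : Fin 4)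
    (u : n → ℂ) : 0 ≤ (star u ⬝ᵥ ((1 - F μ) *ᵥ u)).re := by
  rw [sub_mulVec, one_mulVec, dotProduct_sub, Complex.sub_re, re_star_dotProduct_self]
  have h := abs_re_star_dotProduct_le u (F μ *ᵥ u)
  rw [eucNorm_mulVec_of_conjTranspose_mul_self (hF μ), abs_le] at h
  nlinarith [h.2]

/-- `Re ⟨u, K u⟩ ≥ 0`, i.e. `1 − h ≥ 0` (`‖h‖ ≤ 1`). [folklore] -/
theorem re_star_dotProduct_K_mulVec_nonneg (hF : ∀ μ, (F μ)ᴴ * F μ = 1) (μ : Fin 4)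
    (u : n → ℂ) : 0 ≤ (star u ⬝ᵥ ((1 - F μ + (1 - (F μ)ᴴ)) *ᵥ u)).re := by
  have h1 := re_star_dotProduct_one_sub_mulVec_nonneg F hF μ u
  have h2 : (star u ⬝ᵥ (((1 : Matrix n n ℂ) - (F μ)ᴴ) *ᵥ u)).re =
      (star u ⬝ᵥ ((1 - F μ) *ᵥ u)).re := by
    rw [← re_star_dotProduct_conjTranspose_mulVec ((1 : Matrix n n ℂ) - F μ),
      conjTranspose_sub, conjTranspose_one]
  rw [add_mulVec, dotProduct_add, Complex.add_re, h2]
  linarith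

/-- `‖(1 - F) u‖ ≤ 2‖u‖`. [folklore] -/
theorem eucNorm_one_sub_mulVec_le (hF : ∀ μ, (F μ)ᴴ * F μ = 1) (μ : Fin 4) (u : n → ℂ) :
    eucNorm ((1 - F μ) *ᵥ u) ≤ 2 * eucNorm u := by
  rw [sub_mulVec, one_mulVec, two_mul]
  refine (eucNorm_sub_le _ _).trans ?_
  rw [eucNorm_mulVec_of_conjTranspose_mul_self (hF μ)]

/-- `‖(1 - F)ᴴ u‖ ≤ 2‖u‖`. [folklore] -/
theorem eucNorm_one_sub_conjTranspose_mulVec_le (hF' : ∀ μ, F μ * (F μ)ᴴ = 1) (μ : Fin 4)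
    (u : n → ℂ) : eucNorm ((1 - F μ)ᴴ *ᵥ u) ≤ 2 * eucNorm u := by
  rw [conjTranspose_sub, conjTranspose_one, sub_mulVec, one_mulVec, two_mul]
  refine (eucNorm_sub_le _ _).trans ?_
  have h : ((F μ)ᴴ)ᴴ * (F μ)ᴴ = 1 := by rw [conjTranspose_conjTranspose, hF']
  rw [eucNorm_mulVec_of_conjTranspose_mul_self h]

omit [Fintype n] in
/-- `K = (1 − F) + (1 − F)ᴴ` is Hermitian. [folklore] -/
theorem conjTranspose_K (μ : Fin 4) : ((1 - F μ + (1 - (F μ)ᴴ)))ᴴ = (1 - F μ + (1 - (F μ)ᴴ)) := by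
  rw [conjTranspose_add, conjTranspose_sub, conjTranspose_sub, conjTranspose_one,
    conjTranspose_conjTranspose, add_comm]

variable {S : n → Prop} {δ : ℝ}

/-- **`Z`-type bound**: `‖[K_μ, Δ_ν] w‖ ≤ 4δ‖w‖` when the mixed commutators are `δ`-small on
`w`. [cite: Neuberger2000Bounds, §Lower bound] -/
theorem eucNorm_K_comm_delta_mulVec_le
    (hC : ∀ w : n → ℂ, (∀ p, w p ≠ 0 → S p) → ∀ μ ν : Fin 4, μ ≠ ν →
      eucNorm ((F μ * F ν - F ν * F μ) *ᵥ w) ≤ δ * eucNorm w ∧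
      eucNorm ((F μ * (F ν)ᴴ - (F ν)ᴴ * F μ) *ᵥ w) ≤ δ * eucNorm w ∧
      eucNorm (((F μ)ᴴ * (F ν)ᴴ - (F ν)ᴴ * (F μ)ᴴ) *ᵥ w) ≤ δ * eucNorm w)
    {μ ν : Fin 4} (hμν : μ ≠ ν)
    (w : n → ℂ) (hw : ∀ p, w p ≠ 0 → S p) :
    eucNorm (((1 - F μ + (1 - (F μ)ᴴ)) * ((F ν)ᴴ - F ν) -
        ((F ν)ᴴ - F ν) * (1 - F μ + (1 - (F μ)ᴴ))) *ᵥ w) ≤ 4 * (δ * eucNorm w) := by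
  obtain ⟨h1, h2, h3⟩ := hC w hw μ ν hμν
  obtain ⟨-, h2', -⟩ := hC w hw ν μ hμν.symm
  rw [K_comm_delta, neg_mulVec, eucNorm_neg, add_mulVec, add_mulVec, sub_mulVec]
  calc _ ≤ eucNorm ((F μ * (F ν)ᴴ - (F ν)ᴴ * F μ) *ᵥ w - (F μ * F ν - F ν * F μ) *ᵥ w +
          ((F μ)ᴴ * (F ν)ᴴ - (F ν)ᴴ * (F μ)ᴴ) *ᵥ w) +
          eucNorm ((F ν * (F μ)ᴴ - (F μ)ᴴ * F ν) *ᵥ w) := eucNorm_add_le _ _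
    _ ≤ eucNorm ((F μ * (F ν)ᴴ - (F ν)ᴴ * F μ) *ᵥ w - (F μ * F ν - F ν * F μ) *ᵥ w) +
          eucNorm (((F μ)ᴴ * (F ν)ᴴ - (F ν)ᴴ * (F μ)ᴴ) *ᵥ w) +
          eucNorm ((F ν * (F μ)ᴴ - (F μ)ᴴ * F ν) *ᵥ w) := by
        gcongr; exact eucNorm_add_le _ _
    _ ≤ eucNorm ((F μ * (F ν)ᴴ - (F ν)ᴴ * F μ) *ᵥ w) + eucNorm ((F μ * F ν - F ν * F μ) *ᵥ w) +
          eucNorm (((F μ)ᴴ * (F ν)ᴴ - (F ν)ᴴ * (F μ)ᴴ) *ᵥ w) +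
          eucNorm ((F ν * (F μ)ᴴ - (F μ)ᴴ * F ν) *ᵥ w) := by
        gcongr; exact eucNorm_sub_le _ _
    _ ≤ δ * eucNorm w + δ * eucNorm w + δ * eucNorm w + δ * eucNorm w := by gcongr
    _ = 4 * (δ * eucNorm w) := by ring

/-- **`Y`-type bound**: `‖[Δ_μ, Δ_ν] w‖ ≤ 4δ‖w‖` when the mixed commutators are `δ`-small on
`w`. [cite: Neuberger2000Bounds, §Lower bound] -/
theorem eucNorm_delta_comm_delta_mulVec_le
    (hC : ∀ w : n → ℂ, (∀ p, w p ≠ 0 → S p) → ∀ μ ν : Fin 4, μ ≠ ν →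
      eucNorm ((F μ * F ν - F ν * F μ) *ᵥ w) ≤ δ * eucNorm w ∧
      eucNorm ((F μ * (F ν)ᴴ - (F ν)ᴴ * F μ) *ᵥ w) ≤ δ * eucNorm w ∧
      eucNorm (((F μ)ᴴ * (F ν)ᴴ - (F ν)ᴴ * (F μ)ᴴ) *ᵥ w) ≤ δ * eucNorm w)
    {μ ν : Fin 4} (hμν : μ ≠ ν)
    (w : n → ℂ) (hw : ∀ p, w p ≠ 0 → S p) :
    eucNorm ((((F μ)ᴴ - F μ) * ((F ν)ᴴ - F ν) - ((F ν)ᴴ - F ν) * ((F μ)ᴴ - F μ)) *ᵥ w) ≤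
      4 * (δ * eucNorm w) := by
  obtain ⟨h1, h2, h3⟩ := hC w hw μ ν hμν
  obtain ⟨-, h2', -⟩ := hC w hw ν μ hμν.symm
  rw [delta_comm_delta, sub_mulVec, add_mulVec, add_mulVec]
  calc _ ≤ eucNorm (((F μ)ᴴ * (F ν)ᴴ - (F ν)ᴴ * (F μ)ᴴ) *ᵥ w + (F μ * F ν - F ν * F μ) *ᵥ w +
          (F ν * (F μ)ᴴ - (F μ)ᴴ * F ν) *ᵥ w) +
          eucNorm ((F μ * (F ν)ᴴ - (F ν)ᴴ * F μ) *ᵥ w) := eucNorm_sub_le _ _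
    _ ≤ eucNorm (((F μ)ᴴ * (F ν)ᴴ - (F ν)ᴴ * (F μ)ᴴ) *ᵥ w + (F μ * F ν - F ν * F μ) *ᵥ w) +
          eucNorm ((F ν * (F μ)ᴴ - (F μ)ᴴ * F ν) *ᵥ w) +
          eucNorm ((F μ * (F ν)ᴴ - (F ν)ᴴ * F μ) *ᵥ w) := by
        gcongr; exact eucNorm_add_le _ _
    _ ≤ eucNorm (((F μ)ᴴ * (F ν)ᴴ - (F ν)ᴴ * (F μ)ᴴ) *ᵥ w) +
          eucNorm ((F μ * F ν - F ν * F μ) *ᵥ w) +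
          eucNorm ((F ν * (F μ)ᴴ - (F μ)ᴴ * F ν) *ᵥ w) +
          eucNorm ((F μ * (F ν)ᴴ - (F ν)ᴴ * F μ) *ᵥ w) := by
        gcongr; exact eucNorm_add_le _ _
    _ ≤ δ * eucNorm w + δ * eucNorm w + δ * eucNorm w + δ * eucNorm w := by gcongr
    _ = 4 * (δ * eucNorm w) := by ring

omit [DecidableEq n] in
/-- `⟨w, (A M Aᴴ) w⟩ = ⟨Aᴴ w, M (Aᴴ w)⟩`. [folklore] -/
theorem star_dotProduct_conj_mulVec (A M : Matrix n n ℂ) (w : n → ℂ) :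
    star w ⬝ᵥ ((A * M * Aᴴ) *ᵥ w) = star (Aᴴ *ᵥ w) ⬝ᵥ (M *ᵥ (Aᴴ *ᵥ w)) := by
  rw [← mulVec_mulVec, ← mulVec_mulVec, star_mulVec, ← dotProduct_mulVec,
    conjTranspose_conjTranspose]

omit [DecidableEq n] in
/-- `⟨w, (A N) w⟩ = ⟨Aᴴ w, N w⟩`. [folklore] -/
theorem star_dotProduct_mul_mulVec (A N : Matrix n n ℂ) (w : n → ℂ) :
    star w ⬝ᵥ ((A * N) *ᵥ w) = star (Aᴴ *ᵥ w) ⬝ᵥ (N *ᵥ w) := by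
  rw [← mulVec_mulVec, star_mulVec, ← dotProduct_mulVec, conjTranspose_conjTranspose]

/-- **`Q + X` bound**: `Re ⟨K_μ w, K_ν w⟩ ≥ −4δ‖w‖²` for `μ ≠ ν` — the conjugated terms
`B K Bᴴ`, `Bᴴ K B` are positive and the commutator terms are `δ`-small (`‖B^{(†)} w‖ ≤ 2‖w‖`).
[cite: Neuberger2000Bounds, §Lower bound] -/
theorem re_star_dotProduct_K_mulVec_K_mulVec_ge (hF : ∀ μ, (F μ)ᴴ * F μ = 1)
    (hF' : ∀ μ, F μ * (F μ)ᴴ = 1)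
    (hC : ∀ w : n → ℂ, (∀ p, w p ≠ 0 → S p) → ∀ μ ν : Fin 4, μ ≠ ν →
      eucNorm ((F μ * F ν - F ν * F μ) *ᵥ w) ≤ δ * eucNorm w ∧
      eucNorm ((F μ * (F ν)ᴴ - (F ν)ᴴ * F μ) *ᵥ w) ≤ δ * eucNorm w ∧
      eucNorm (((F μ)ᴴ * (F ν)ᴴ - (F ν)ᴴ * (F μ)ᴴ) *ᵥ w) ≤ δ * eucNorm w)
    {μ ν : Fin 4}
    (hμν : μ ≠ ν) (w : n → ℂ) (hw : ∀ p, w p ≠ 0 → S p) :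
    -(4 * (δ * eucNorm w ^ 2)) ≤
      (star ((1 - F μ + (1 - (F μ)ᴴ)) *ᵥ w) ⬝ᵥ ((1 - F ν + (1 - (F ν)ᴴ)) *ᵥ w)).re := by
  have h2w : (0 : ℝ) ≤ 2 * eucNorm w := mul_nonneg zero_le_two (eucNorm_nonneg _)
  obtain ⟨h1, h2, -⟩ := hC w hw μ ν hμν
  obtain ⟨-, h2', h3'⟩ := hC w hw ν μ hμν.symm
  have h0 : star ((1 - F μ + (1 - (F μ)ᴴ)) *ᵥ w) ⬝ᵥ ((1 - F ν + (1 - (F ν)ᴴ)) *ᵥ w) =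
      star w ⬝ᵥ (((1 - F μ + (1 - (F μ)ᴴ)) * (1 - F ν + (1 - (F ν)ᴴ))) *ᵥ w) := by
    rw [star_mulVec, ← dotProduct_mulVec, conjTranspose_K, mulVec_mulVec]
  have hI := two_nsmul_K_mul_K F hF hF' μ ν
  rw [two_nsmul] at hI
  have key := congrArg (fun M : Matrix n n ℂ => (star w ⬝ᵥ (M *ᵥ w)).re) hI
  simp only [add_mulVec, sub_mulVec, dotProduct_add, dotProduct_sub, Complex.add_re,
    Complex.sub_re] at key
  -- the two positive terms
  have hP1 : 0 ≤ (star w ⬝ᵥ (((1 - F μ) * (1 - F ν + (1 - (F ν)ᴴ)) * (1 - F μ)ᴴ) *ᵥ w)).re := by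
    rw [star_dotProduct_conj_mulVec]
    exact re_star_dotProduct_K_mulVec_nonneg F hF ν _
  have hP2 : 0 ≤ (star w ⬝ᵥ (((1 - F μ)ᴴ * (1 - F ν + (1 - (F ν)ᴴ)) * (1 - F μ)) *ᵥ w)).re := by
    have : (1 - F μ)ᴴ * (1 - F ν + (1 - (F ν)ᴴ)) * (1 - F μ) =
        (1 - F μ)ᴴ * (1 - F ν + (1 - (F ν)ᴴ)) * ((1 - F μ)ᴴ)ᴴ := by
      rw [conjTranspose_conjTranspose]
    rw [this, star_dotProduct_conj_mulVec]
    exact re_star_dotProduct_K_mulVec_nonneg F hF ν _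
  -- the two commutator terms
  have hB := eucNorm_one_sub_mulVec_le F hF μ w
  have hBt := eucNorm_one_sub_conjTranspose_mulVec_le F hF' μ w
  have hQ1 : |(star w ⬝ᵥ (((1 - F μ) * ((1 - F ν + (1 - (F ν)ᴴ)) * (1 - F μ)ᴴ -
      (1 - F μ)ᴴ * (1 - F ν + (1 - (F ν)ᴴ)))) *ᵥ w)).re| ≤
      2 * eucNorm w * (2 * (δ * eucNorm w)) := by
    rw [star_dotProduct_mul_mulVec]
    refine (abs_re_star_dotProduct_le _ _).trans ?_
    have hc : eucNorm (((1 - F ν + (1 - (F ν)ᴴ)) * (1 - F μ)ᴴ -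
        (1 - F μ)ᴴ * (1 - F ν + (1 - (F ν)ᴴ))) *ᵥ w) ≤ 2 * (δ * eucNorm w) := by
      rw [K_comm_one_sub_conjTranspose, add_mulVec, two_mul]
      exact (eucNorm_add_le _ _).trans (add_le_add h2' h3')
    exact mul_le_mul hBt hc (eucNorm_nonneg _) h2w
  have hQ2 : |(star w ⬝ᵥ (((1 - F μ)ᴴ * ((1 - F ν + (1 - (F ν)ᴴ)) * (1 - F μ) -
      (1 - F μ) * (1 - F ν + (1 - (F ν)ᴴ)))) *ᵥ w)).re| ≤
      2 * eucNorm w * (2 * (δ * eucNorm w)) := by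
    rw [star_dotProduct_mul_mulVec, conjTranspose_conjTranspose]
    refine (abs_re_star_dotProduct_le _ _).trans ?_
    have hc : eucNorm (((1 - F ν + (1 - (F ν)ᴴ)) * (1 - F μ) -
        (1 - F μ) * (1 - F ν + (1 - (F ν)ᴴ))) *ᵥ w) ≤ 2 * (δ * eucNorm w) := by
      rw [K_comm_one_sub, sub_mulVec, neg_mulVec, two_mul]
      refine (eucNorm_sub_le _ _).trans (add_le_add ?_ h2)
      rw [eucNorm_neg]; exact h1
    exact mul_le_mul hB hc (eucNorm_nonneg _) h2w
  rw [abs_le] at hQ1 hQ2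
  rw [h0]
  nlinarith [hQ1.1, hQ2.1, hP1, hP2, key]

end HoppingBounds

end Literature.MathematicalPhysics.QuantumLattice.NeubergerBound
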